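import Mathlib
import HarnessLib
import Summits.HubbardSuperconductivity.HubbardSuperconductivity.Theorems.KLProgrammeKLRegimeWickCrossContractionGramLines
import Summits.HubbardSuperconductivity.HubbardSuperconductivity.Theorems.KLProgrammeKLRegimeWickStepLines
import Summits.HubbardSuperconductivity.HubbardSuperconductivity.Theorems.KLProgrammeKLRegimeKernelNormsLevelsDefs

/-!
# Route `KLProgramme` — ENGINE child gen 6 (stmt-HubbardSuperconductivity-20236 `KLRegimeEngineV16`), `stub_engine_step_values` (E2-v10):
# the `j`-line term of `klw_wickPairAmplitude_succ_lines` as `j` one-slice-line terms ON THE MODEL'S CARRIERS, and the sector LEVEL of the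
# Gram-tail prescription (cell gate-hubbard-kl, seat p5 g5; sequel to `…WickCrossContractionGram{,Lines,Value}`)

* **`klw_vertexFn_dblFold_pow_sub_pow_eq_sum`** — with `D_n = D_{n+1} + g_{n+1}` (`klw_softCov_eq_succ_add_slice`, p481972) and
  `crossLaplacian_pow_sub_pow` (this seat): for every `P` and every leg tuple,
  `𝒱_m[dblFold((Δ_×(D_n)^j − Δ_×(D_{n+1})^j) P)](Z) = Σ_{i<j} 𝒱_m[dblFold((Δ_×(D_n)^i·Δ_×(D_{n+1})^{j−1−i}·Δ_×(g_{n+1})) P)](Z)` — the `j`-th term of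
  `klw_wickPairAmplitude_succ_lines` (p504266) is a sum of `j` terms each with exactly ONE slice line `g_{n+1}` acting first and `j − 1` soft lines,
  the format of `norm_kernel_crossLaplacian_pow_mul_pow_mul_le_gram` / `listProd_cons_append_const` (this seat) after the transport
  `dblFold_crossContract_map` (p512067);
* `klw_kernel_dblFold_pow_sub_pow_eq_sum` — the same for kernels;
* **`levelCount_gramTailPrescription`** — the prescription of the value form with a Gram tail
  (`…GramValue.norm_kernel_crossContract_value_sectorPreimage_le_gram`: line-`0` leg, explicit legs `1 … e'` and the `m₁` free legs of `Gb` prescribed,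
  its `k − e' − 1` Gram legs free) has `levelCount = e' + 1 + m₁`; so `e' + 1 + m₁ ≥ 5` reads `Gb` at the top of BGM (2.98) (`levelGainExp = 2`,
  `levelGainExp_eq_two_of_le`) — the E.5 gain `4^{-n}` with NO factorial in the line number.

Proved; no definitions; exact identities and a count; nothing about sizes is asserted.
-/

noncomputable section

namespace Summit.HubbardSuperconductivity.HubbardSuperconductivity.Theorems.KLRegimeWick

set_option linter.dupNamespace false -- summit = problem name (single-conjunct summit), D-0017

open Literature.MathematicalPhysics.QuantumLattice GrassmannAlgebra Finset Matrix
open Literature.Probability.LatticeModels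
open Summit.HubbardSuperconductivity.HubbardSuperconductivity.Theorems.TwoPointAssembly
open Summit.HubbardSuperconductivity.HubbardSuperconductivity.Theorems.KLProgrammeLegKernels
open Summit.HubbardSuperconductivity.HubbardSuperconductivity.Theorems.KLRegimeSplit

/-! ## §1 The `j`-line term of the step as `j` one-slice-line terms -/

section Model

variable (L M : ℕ) [NeZero L] [NeZero M] (β U μ : ℝ) (K : TrigPolyC4v)

omit [NeZero M] in
/-- **The `j`-line term of the Wick step as `j` one-slice-line terms (kernels)**:
`kernel (dblFold((Δ_×(D_n)^j − Δ_×(D_{n+1})^j) P)) = Σ_{i<j} kernel (dblFold((Δ_×(D_n)^i·Δ_×(D_{n+1})^{j−1−i}·Δ_×(g_{n+1})) P))`. -/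
theorem klw_kernel_dblFold_pow_sub_pow_eq_sum (n j m : ℕ) (P : GrassmannAlgebra ℂ (HubbardFieldIdx L M × Fin 2))
    (Z : Fin m → HubbardFieldIdx L M) :
    kernel ℂ (dblFold ℂ ((grassmannLaplacian ℂ (crossCov ℂ (klSoftCov L M β μ K n)) ^ j) P -
        (grassmannLaplacian ℂ (crossCov ℂ (klSoftCov L M β μ K (n + 1))) ^ j) P)) m Z =
      ∑ i ∈ Finset.range j, kernel ℂ (dblFold ℂ ((grassmannLaplacian ℂ (crossCov ℂ (klSoftCov L M β μ K n)) ^ i *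
        grassmannLaplacian ℂ (crossCov ℂ (klSoftCov L M β μ K (n + 1))) ^ (j - 1 - i) *
          grassmannLaplacian ℂ (crossCov ℂ (klSliceCov L M β μ K (n + 1)))) P)) m Z := by
  have hop := crossLaplacian_pow_sub_pow ℂ (klSoftCov L M β μ K (n + 1)) (klSliceCov L M β μ K (n + 1)) j
  rw [← klw_softCov_eq_succ_add_slice] at hop
  rw [← LinearMap.sub_apply, hop, Finset.sum_mul, LinearMap.sum_apply, map_sum, kernel_sum]

omit [NeZero M] in
/-- **The `j`-line term of `klw_wickPairAmplitude_succ_lines` as `j` one-slice-line terms (vertex functions)**: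
`𝒱_m[dblFold((Δ_×(D_n)^j − Δ_×(D_{n+1})^j) P)](Z) = Σ_{i<j} 𝒱_m[dblFold((Δ_×(D_n)^i·Δ_×(D_{n+1})^{j−1−i}·Δ_×(g_{n+1})) P)](Z)`. -/
theorem klw_vertexFn_dblFold_pow_sub_pow_eq_sum (n j m : ℕ) (P : GrassmannAlgebra ℂ (HubbardFieldIdx L M × Fin 2))
    (Z : Fin m → HubbardFieldIdx L M) :
    vertexFn L M β (dblFold ℂ ((grassmannLaplacian ℂ (crossCov ℂ (klSoftCov L M β μ K n)) ^ j) P -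
        (grassmannLaplacian ℂ (crossCov ℂ (klSoftCov L M β μ K (n + 1))) ^ j) P)) m Z =
      ∑ i ∈ Finset.range j, vertexFn L M β (dblFold ℂ ((grassmannLaplacian ℂ (crossCov ℂ (klSoftCov L M β μ K n)) ^ i *
        grassmannLaplacian ℂ (crossCov ℂ (klSoftCov L M β μ K (n + 1))) ^ (j - 1 - i) *
          grassmannLaplacian ℂ (crossCov ℂ (klSliceCov L M β μ K (n + 1)))) P)) m Z := by
  have hop := crossLaplacian_pow_sub_pow ℂ (klSoftCov L M β μ K (n + 1)) (klSliceCov L M β μ K (n + 1)) j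
  rw [← klw_softCov_eq_succ_add_slice] at hop
  rw [← LinearMap.sub_apply, hop, Finset.sum_mul, LinearMap.sum_apply, map_sum, klw_vertexFn_finset_sum]

end Model

/-! ## §2 The level of the Gram-tail prescription -/

section Level

variable {N : ℕ}

/-- **The level of the Gram-tail prescription**: the line-`0` leg, the explicit legs `1 … e'` and the `m₁` free legs prescribed, the
`k − e' − 1` Gram legs free: `levelCount = e' + 1 + m₁`. [folklore] -/
theorem levelCount_gramTailPrescription {k e' m₁ : ℕ} (he : e' + 1 ≤ k) (ω : Fin (e' + 1) → SectorLeg N) (ω₁ : Fin m₁ → SectorLeg N) :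
    levelCount (Fin.append (fun i : Fin k => if h : (i : ℕ) < e' + 1 then some (ω ⟨i, h⟩) else none) (fun j => some (ω₁ j))) =
      e' + 1 + m₁ := by
  classical
  rw [levelCount]
  have hinj : Function.Injective fun a : Fin (e' + 1) => Fin.castAdd m₁ (Fin.castLE he a) :=
    fun a b hab => Fin.castLE_injective he (Fin.castAdd_injective _ _ hab)
  -- the prescribed legs: the first `e' + 1` legs of the first block and the whole second block
  have hsplit : (univ.filter fun i : Fin (k + m₁) => ((Fin.append (fun i : Fin k => if h : (i : ℕ) < e' + 1 then some (ω ⟨i, h⟩) else none)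
      (fun j => some (ω₁ j)) : Fin (k + m₁) → Option (SectorLeg N)) i).isSome) =
      (univ : Finset (Fin (e' + 1))).map ⟨_, hinj⟩ ∪ (univ : Finset (Fin m₁)).map (Fin.natAddEmb k) := by
    ext i
    simp only [mem_filter, mem_univ, true_and, mem_union, mem_map, Function.Embedding.coeFn_mk, Fin.natAddEmb_apply]
    refine Fin.addCases (fun i' => ?_) (fun j => ?_) i
    · rw [Fin.append_left]
      constructor
      · intro h
        by_cases hi : (i' : ℕ) < e' + 1
        · exact Or.inl ⟨⟨i', hi⟩, Fin.ext rfl⟩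
        · rw [dif_neg hi] at h
          exact absurd h (by simp)
      · rintro (⟨a, ha⟩ | ⟨j, hj⟩)
        · have ha' : Fin.castLE he a = i' := Fin.castAdd_injective _ _ ha
          have hi : (i' : ℕ) < e' + 1 := by rw [← ha']; exact a.isLt
          rw [dif_pos hi, Option.isSome_some]
        · have hv := congrArg Fin.val hj
          simp only [Fin.val_natAdd, Fin.val_castAdd] at hv
          have := i'.isLt
          omega
    · rw [Fin.append_right]
      simp only [Option.isSome_some, true_iff]
      exact Or.inr ⟨j, rfl⟩
  have hdisj : Disjoint ((univ : Finset (Fin (e' + 1))).map ⟨_, hinj⟩) ((univ : Finset (Fin m₁)).map (Fin.natAddEmb k)) := by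
    rw [Finset.disjoint_left]
    intro x hx hx'
    simp only [mem_map, mem_univ, true_and, Function.Embedding.coeFn_mk, Fin.natAddEmb_apply] at hx hx'
    obtain ⟨a, rfl⟩ := hx
    obtain ⟨j, hj⟩ := hx'
    have hv := congrArg Fin.val hj
    simp only [Fin.val_natAdd, Fin.val_castAdd, Fin.val_castLE] at hv
    have := a.isLt
    omega
  rw [hsplit, card_union_of_disjoint hdisj, card_map, card_map, card_univ, card_univ, Fintype.card_fin, Fintype.card_fin]

/-- `levelGainExp F = 2` as soon as `F ≥ 5` (BGM (2.98): all levels from the fifth on gain `γ^h = 4^{-n}`). [folklore] -/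
theorem levelGainExp_eq_two_of_le {F : ℕ} (hF : 5 ≤ F) : levelGainExp F = 2 := by
  rw [levelGainExp]
  have h : 2 ≤ (F - 1) / 2 := by omega
  omega

end Level

end Summit.HubbardSuperconductivity.HubbardSuperconductivity.Theorems.KLRegimeWick

end
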